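import Literature.NumberTheory.LFunctions.RealZeroGlobalLogDerivBound
import Literature.NumberTheory.LFunctions.NoRealZeroPrimeSumCriterion
import Literature.Analysis.ValidatedNumerics.DigammaKernelValues
import HarnessLib

/-!
# Lu–Zaman–Zhao's Theorem 2.1 for moduli `q ≤ 4·10⁵`, proved from the global partial-fraction
# inequality with the partner zero

Topic `Literature/NumberTheory/LFunctions` (namespace `Literature.NumberTheory.LFunctions.LuZamanZhao2026`).
Everything here is PROVED (standard axioms; eight `decide +kernel` interval evaluations of `ψ`, `log`, `π`).

Lu–Zaman–Zhao (Math. Comp. 2026, Theorem 2.1, typed AS PRINTED as the named fact `theorem21` in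
`NoRealZeroPrimeSumCriterion.lean`) bound, for a primitive `χ` mod `q` with a real zero `β₁` and
`σ = 1 + r`, `R = r + 7/8`,
`Σ_n Λ(n)(1 + Re χ(n))/n^σ ≤ 1/r − 1/(σ − β₁) + (σ − β₁)/R² + ϕ log q + E` with `(r, ϕ, E)` from their
Table 1 (`ϕ ≈ 0.23`). Their proof (Cor. 6.4, 14 pp.) is not in the tree. The CLASSICAL global inequality
(Davenport Ch. 12; all inputs proved in `RealZeroGlobalLogDerivBound.lean`) gives instead
`Σ ≤ 1/r − ½log π + ½ψ((3+r)/2) + ½log q − ½log π + ½ψ((1+κ+r)/2) − 1/(σ−β₁) − 1/(r+β₁)`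
(`κ` the parity), i.e. the constant `½` in front of `log q` but, thanks to the PARTNER ZERO `1 − β₁`, the
bonus `−1/(r+β₁) < −1/(1+r) ≈ −0.935`. For `q ≤ 4·10⁵` the right side of the classical inequality is the
SMALLER one, for all four rows and both parities, uniformly in `β₁ ∈ (½, 1)`:

* `theorem21UpTo Q` — the printed statement restricted to `3 ≤ q ≤ Q` and `β₁ ∈ (½, 1)` (the range the
  certificate decision rule uses on windows `[1 − c/log q, 1)`, `c ≤ ½`); `theorem21UpTo_of_theorem21`,
  `theorem21UpTo.mono`;
* `GlobalBoundNumerics.gapCheck` / `gapCheck_sound` — kernel interval evaluation (engine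
  `Literature/Analysis/ValidatedNumerics`: `MI`/`MC` at scale `2⁶⁴`, `MC.digammaBox` = shifted Stirling series
  with certified remainder, `MI.logNat2`, `MI.piMachin`) of the gap
  `−log π + ½ψ((3+r)/2) + ½ψ((1+κ+r)/2) + (½ − ϕ) log(4·10⁵) − 1/(1+r) − r/R² − E`, certified `< 0` for the
  eight (row, parity) pairs (`gapCheck_16_odd` … `gapCheck_11_even`; thinnest `λ = 1.6` odd: `≈ −0.0208`,
  enclosure width `< 10⁻⁹`); `gap_neg` = the eight checks as one real inequality;
* **`theorem21UpTo_fourHundredThousand : theorem21UpTo 400000`** — the restricted Theorem 2.1, PROVED.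

Use: `NoRealZeroCertificateReplayUpTo.lean` re-runs the decision rule and the light/heavy replay glue on
`theorem21UpTo Q` instead of `theorem21`, making the kernel replay of the 243 107 Table-1 certificates
below `4·10⁵` (`parity-realchar` cell) an UNCONDITIONAL proof of `NoExceptionalZeroUpTo 400000 (1/5)`.
WHAT THIS IS NOT: not a proof of Theorem 2.1 as printed (for `q ≳ 4.3·10⁵` and odd `χ` the classical `½`
loses to the printed `ϕ = 0.22675`); nothing is claimed beyond `4·10⁵` or at `β₁ = ½`.

## References

* R. F. Lu, A. Zaman, H. Zhao, Math. Comp. (2026), doi:10.1090/mcom/4268 = arXiv:2602.03626, Theorem 2.1,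
  Table 1. [LuZamanZhao2026]
* H. Davenport, *Multiplicative Number Theory*, 3rd ed., GTM 74, Ch. 12 (17)–(18), Ch. 14. [DavenportMNT1980]
* K. S. McCurley, J. Number Theory 19 (1984) 7–32, Lemma 5. [McCurley1984ZFR]
* R. E. Moore, *Interval Analysis*, Prentice-Hall 1966, Ch. 3–4. [Moore1966]
* H. L. Montgomery, R. C. Vaughan, *Multiplicative Number Theory I*, CUP 2007, (10.30), (C.10). [MontgomeryVaughan2007]
-/

noncomputable section

open Real Complex

namespace Literature.NumberTheory.LFunctions

namespace LuZamanZhao2026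

open scoped ArithmeticFunction.vonMangoldt

/-! ### The restricted statement -/

/-- **Lu–Zaman–Zhao's Theorem 2.1 restricted to moduli `q ≤ Q` and real zeros `β₁ ∈ (½, 1)`:**
for every `3 ≤ q ≤ Q`, every primitive `χ` mod `q`, every real zero `β₁ ∈ (½, 1)` of `L(s, χ)` and
every row `(λ, ϕ, E)` of Table 1 (`r = λ/(10 log 10)`, `σ = 1 + r`, `R = r + 7/8`),
`Σ_n Λ(n)(1 + Re χ(n))/n^σ ≤ 1/r − 1/(σ − β₁) + (σ − β₁)/R² + ϕ log q + E`.
A weakening of `theorem21` (`theorem21UpTo_of_theorem21`); PROVED below for `Q = 4·10⁵`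
(`theorem21UpTo_fourHundredThousand`) from the global partial-fraction inequality with the partner
zero (`RealZeroGlobalLogDerivBound.lean`), independently of the printed proof. This is the
hypothesis actually consumed by the certificate decision rule on the window `[1 − c/log q, 1)`,
`c ≤ ½` (`NoRealZeroCertificateReplayUpTo.lean`). [cite: LuZamanZhao2026, Theorem 2.1 and Table 1] -/
def theorem21UpTo (Q : ℕ) : Prop :=
  ∀ (q : ℕ) [NeZero q], 3 ≤ q → q ≤ Q → ∀ χ : DirichletCharacter ℂ q, χ.IsPrimitive →
    ∀ β₁ : ℝ, 1 / 2 < β₁ → β₁ < 1 → χ.LFunction β₁ = 0 →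
      ∀ lam phi E : ℝ, Table1 lam phi E →
        ∑' n : ℕ, (Λ n : ℝ) * (1 + (χ (n : ZMod q)).re) / (n : ℝ) ^ (1 + rOf lam) ≤
          1 / rOf lam - 1 / (1 + rOf lam - β₁) + (1 + rOf lam - β₁) / (rOf lam + 7 / 8) ^ 2 +
            phi * Real.log q + E

/-- The printed Theorem 2.1 implies its restriction to any range of moduli. [cite: LuZamanZhao2026, Theorem 2.1] -/
theorem theorem21UpTo_of_theorem21 (h : theorem21) (Q : ℕ) : theorem21UpTo Q :=
  fun q _ hq _ χ hχ β₁ hβ hβ1 hL lam phi E hrow ↦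
    h q hq χ hχ β₁ (by linarith) hβ1 hL lam phi E hrow

/-- Shrinking the range of moduli. [cite: LuZamanZhao2026, Theorem 2.1] -/
theorem theorem21UpTo.mono {Q Q' : ℕ} (h : theorem21UpTo Q) (hQ : Q' ≤ Q) : theorem21UpTo Q' :=
  fun q _ hq hq' χ hχ β₁ hβ hβ1 hL lam phi E hrow ↦
    h q hq (hq'.trans hQ) χ hχ β₁ hβ hβ1 hL lam phi E hrow

/-! ### Kernel numerics: the threshold gap at `q = 4·10⁵` -/

namespace GlobalBoundNumerics

open Literature.Analysis.ValidatedNumerics Literature.Analysis.ValidatedNumerics.NumericsMP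

variable (S K J : ℕ)

/-- Interval enclosure of the threshold gap
`−log π + ½ψ((3+r)/2) + ½ψ((1+κ+r)/2) + (pn/pd)·log 400000 − 1/(1+r) − r/(r+7/8)² − en/ed`,
`r = (lamNum/100)/log 10` (`none` if an intermediate enclosure is unavailable). [cite: Moore1966, Ch. 3–4 (interval extensions)] -/
def gapMI (lamNum pn pd en ed κ : ℕ) : Option MI :=
  match MI.piMachin S K, MI.logNat2 S K 10, MI.logNat2 S K 400000 with
  | some P, some L10, some LQ =>
    match MI.divPos S (MI.ofFrac S (lamNum : ℤ) 100) L10, MI.logPos S K P with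
    | some R, some LP =>
      match MC.digammaBox S K J P MC.bernoulliTable (MC.ofMI S (((MI.ofInt S 3).add R).divNat 2)),
            MC.digammaBox S K J P MC.bernoulliTable
              (MC.ofMI S (((MI.ofInt S ((1 : ℤ) + (κ : ℤ))).add R).divNat 2)),
            MI.divPos S (MI.ofInt S 1) ((MI.ofInt S 1).add R),
            MI.divPos S R (MI.sqr S (R.add (MI.ofFrac S 7 8))) with
      | some D1, some D2, some I1, some RR =>
        some (((((((LP.neg).add (D1.re.divNat 2)).add (D2.re.divNat 2)).add
                   (MI.mul S LQ (MI.ofFrac S (pn : ℤ) pd))).sub I1).sub RR).sub (MI.ofFrac S (en : ℤ) ed))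
      | _, _, _, _ => none
    | _, _ => none
  | _, _, _ => none

/-- The kernel test: the upper endpoint of `gapMI` is negative. [cite: Moore1966, Ch. 3–4 (interval extensions)] -/
def gapCheck (lamNum pn pd en ed κ : ℕ) : Bool :=
  match gapMI S K J lamNum pn pd en ed κ with
  | some T => decide (T.hi < 0)
  | none => false

variable {S K J} in
/-- **Soundness of `gapCheck`**: a passing check proves the real inequality
`−log π + ½ Re ψ((3+r)/2) + ½ Re ψ((1+κ+r)/2) + (pn/pd) log 400000 − 1/(1+r) − r/(r+7/8)² − en/ed < 0`,
`r = (lamNum/100)/log 10` (inclusion isotonicity of every enclosure used). [cite: Moore1966, Ch. 3–4 (interval extensions)] -/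
theorem gapCheck_sound (hS : 0 < S) {lamNum pn pd en ed κ : ℕ} (hpd : 0 < pd) (hed : 0 < ed)
    (h : gapCheck S K J lamNum pn pd en ed κ = true) {r : ℝ} (hr : r = (lamNum : ℝ) / 100 / Real.log 10) :
    -Real.log Real.pi + (Complex.digamma (((3 + r) / 2 : ℝ) : ℂ)).re / 2
        + (Complex.digamma (((1 + κ + r) / 2 : ℝ) : ℂ)).re / 2
        + Real.log 400000 * ((pn : ℝ) / pd) - 1 / (1 + r) - r / (r + 7 / 8) ^ 2 - (en : ℝ) / ed < 0 := by
  unfold gapCheck at h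
  split at h
  · rename_i T hT
    simp only [decide_eq_true_eq] at h
    unfold gapMI at hT
    split at hT
    · rename_i P L10 LQ hP hL10 hLQ
      split at hT
      · rename_i R LP hR hLP
        split at hT
        · rename_i D1 D2 I1 RR hD1 hD2 hI1 hRR
          simp only [Option.some.injEq] at hT
          subst hT
          have mP := MI.mem_piMachin hS hP
          have mL10 := MI.mem_logNat2 hS hL10
          have mLQ := MI.mem_logNat2 hS hLQ
          have mR : MI.mem S r R := by
            have := MI.mem_divPos hS hR (MI.mem_ofFrac S (lamNum : ℤ) (q := 100) (by norm_num)) mL10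
            rw [hr]; convert this using 1; push_cast; ring
          have mLP := (MI.mem_logPos hS hLP mP).2
          have m3 : MC.mem S ((((3 + r) / 2 : ℝ)) : ℂ) (MC.ofMI S (((MI.ofInt S 3).add R).divNat 2)) := by
            have := MC.mem_ofMI (MI.mem_divNat (MI.mem_add (MI.mem_ofInt S 3) mR) (n := 2) two_pos)
            convert this using 2; push_cast; ring
          have mκ : MC.mem S ((((1 + κ + r) / 2 : ℝ)) : ℂ)
              (MC.ofMI S (((MI.ofInt S ((1 : ℤ) + (κ : ℤ))).add R).divNat 2)) := by
            have := MC.mem_ofMI (MI.mem_divNat (MI.mem_add (MI.mem_ofInt S ((1 : ℤ) + (κ : ℤ))) mR)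
              (n := 2) two_pos)
            convert this using 2; push_cast; ring
          have mD1 := (MC.mem_digammaBox_table hS mP hD1 m3).1
          have mD2 := (MC.mem_digammaBox_table hS mP hD2 mκ).1
          have mI1 : MI.mem S (1 / (1 + r)) I1 := by
            have := MI.mem_divPos hS hI1 (MI.mem_ofInt S 1) (MI.mem_add (MI.mem_ofInt S 1) mR)
            convert this using 1; push_cast; ring
          have mRR : MI.mem S (r / (r + 7 / 8) ^ 2) RR := by
            have := MI.mem_divPos hS hRR mR (MI.mem_sqr hS (MI.mem_add mR (MI.mem_ofFrac S 7 (q := 8)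
              (by norm_num))))
            convert this using 2; push_cast; ring
          have mpn := MI.mem_ofFrac S (pn : ℤ) hpd
          have men := MI.mem_ofFrac S (en : ℤ) hed
          have mT := MI.mem_sub (MI.mem_sub (MI.mem_sub (MI.mem_add (MI.mem_add (MI.mem_add
            (MI.mem_neg mLP) (MI.mem_divNat mD1 (n := 2) two_pos)) (MI.mem_divNat mD2 (n := 2) two_pos))
            (MI.mem_mul hS mLQ mpn)) mI1) mRR) men
          have hneg := MI.neg_of_hi_neg mT h
          push_cast at hneg ⊢
          linarith
        · simp at hT
      · simp at hT
    · simp at hT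
  · simp at h

/-- Fixed-point scale of the kernel run (`2⁶⁴`). [folklore] -/
def S0 : ℕ := 2 ^ 64

/-- Number of series terms for `log` / `arctan` in the kernel run. [folklore] -/
def K0 : ℕ := 40

/-- Stirling shift for `ψ` in the kernel run. [folklore] -/
def J0 : ℕ := 12

/-- `0 < S0`. [folklore] -/
private theorem S0_pos : 0 < S0 := by unfold S0; positivity

/-- Row `λ = 1.6` (`½ − ϕ = 0.27325 = 1093/4000`, `E = 1.1614 = 5807/5000`), odd characters
(gap `≈ −0.0208`, the thinnest of the eight). [cite: LuZamanZhao2026, Table 1] -/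
theorem gapCheck_16_odd : gapCheck S0 K0 J0 16 1093 4000 5807 5000 1 = true := by decide +kernel

/-- Row `λ = 1.6`, even characters (gap `≈ −0.66`). [cite: LuZamanZhao2026, Table 1] -/
theorem gapCheck_16_even : gapCheck S0 K0 J0 16 1093 4000 5807 5000 0 = true := by decide +kernel

/-- Row `λ = 1.3` (`½ − ϕ = 0.26917`, `E = 1.1805 = 2361/2000`), odd (gap `≈ −0.099`). [cite: LuZamanZhao2026, Table 1] -/
theorem gapCheck_13_odd : gapCheck S0 K0 J0 13 26917 100000 2361 2000 1 = true := by decide +kernel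

/-- Row `λ = 1.3`, even. [cite: LuZamanZhao2026, Table 1] -/
theorem gapCheck_13_even : gapCheck S0 K0 J0 13 26917 100000 2361 2000 0 = true := by decide +kernel

/-- Row `λ = 1.2` (`½ − ϕ = 0.26778`, `E = 1.1870 = 1187/1000`), odd (gap `≈ −0.126`). [cite: LuZamanZhao2026, Table 1] -/
theorem gapCheck_12_odd : gapCheck S0 K0 J0 12 26778 100000 1187 1000 1 = true := by decide +kernel

/-- Row `λ = 1.2`, even. [cite: LuZamanZhao2026, Table 1] -/
theorem gapCheck_12_even : gapCheck S0 K0 J0 12 26778 100000 1187 1000 0 = true := by decide +kernel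

/-- Row `λ = 1.1` (`½ − ϕ = 0.26638`, `E = 1.1936 = 1492/1250`), odd (gap `≈ −0.153`). [cite: LuZamanZhao2026, Table 1] -/
theorem gapCheck_11_odd : gapCheck S0 K0 J0 11 26638 100000 1492 1250 1 = true := by decide +kernel

/-- Row `λ = 1.1`, even. [cite: LuZamanZhao2026, Table 1] -/
theorem gapCheck_11_even : gapCheck S0 K0 J0 11 26638 100000 1492 1250 0 = true := by decide +kernel

/-- The eight kernel checks as one real inequality per Table-1 row and parity `κ ≤ 1`:
with `r = λ/(10 log 10)`,
`−log π + ½ Re ψ((3+r)/2) + ½ Re ψ((1+κ+r)/2) + (½ − ϕ) log(4·10⁵) − 1/(1+r) − r/(r+7/8)² − E < 0`.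
[cite: LuZamanZhao2026, Table 1] -/
theorem gap_neg {lam phi E : ℝ} (hrow : Table1 lam phi E) {κ : ℕ} (hκ : κ ≤ 1) :
    -Real.log Real.pi + (Complex.digamma (((3 + rOf lam) / 2 : ℝ) : ℂ)).re / 2
        + (Complex.digamma (((1 + κ + rOf lam) / 2 : ℝ) : ℂ)).re / 2
        + Real.log 400000 * (1 / 2 - phi) - 1 / (1 + rOf lam) - rOf lam / (rOf lam + 7 / 8) ^ 2 - E
          < 0 := by
  have hL : (0 : ℝ) < Real.log 10 := Real.log_pos (by norm_num)
  have hκ' : κ = 0 ∨ κ = 1 := by omega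
  rcases hrow with ⟨rfl, rfl, rfl⟩ | ⟨rfl, rfl, rfl⟩ | ⟨rfl, rfl, rfl⟩ | ⟨rfl, rfl, rfl⟩
  · have hr : rOf (1.6 : ℝ) = ((16 : ℕ) : ℝ) / 100 / Real.log 10 := by
      rw [rOf]; field_simp; norm_num
    have e1 : (((1093 : ℕ) : ℝ) / ((4000 : ℕ) : ℝ)) = 1 / 2 - 0.22675 := by norm_num
    have e2 : (((5807 : ℕ) : ℝ) / ((5000 : ℕ) : ℝ)) = 1.1614 := by norm_num
    rcases hκ' with rfl | rfl
    · have h := gapCheck_sound S0_pos (by norm_num) (by norm_num) gapCheck_16_even hr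
      rw [e1, e2] at h; push_cast at h ⊢; linarith
    · have h := gapCheck_sound S0_pos (by norm_num) (by norm_num) gapCheck_16_odd hr
      rw [e1, e2] at h; push_cast at h ⊢; linarith
  · have hr : rOf (1.3 : ℝ) = ((13 : ℕ) : ℝ) / 100 / Real.log 10 := by
      rw [rOf]; field_simp; norm_num
    have e1 : (((26917 : ℕ) : ℝ) / ((100000 : ℕ) : ℝ)) = 1 / 2 - 0.23083 := by norm_num
    have e2 : (((2361 : ℕ) : ℝ) / ((2000 : ℕ) : ℝ)) = 1.1805 := by norm_num
    rcases hκ' with rfl | rfl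
    · have h := gapCheck_sound S0_pos (by norm_num) (by norm_num) gapCheck_13_even hr
      rw [e1, e2] at h; push_cast at h ⊢; linarith
    · have h := gapCheck_sound S0_pos (by norm_num) (by norm_num) gapCheck_13_odd hr
      rw [e1, e2] at h; push_cast at h ⊢; linarith
  · have hr : rOf (1.2 : ℝ) = ((12 : ℕ) : ℝ) / 100 / Real.log 10 := by
      rw [rOf]; field_simp; norm_num
    have e1 : (((26778 : ℕ) : ℝ) / ((100000 : ℕ) : ℝ)) = 1 / 2 - 0.23222 := by norm_num
    have e2 : (((1187 : ℕ) : ℝ) / ((1000 : ℕ) : ℝ)) = 1.1870 := by norm_num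
    rcases hκ' with rfl | rfl
    · have h := gapCheck_sound S0_pos (by norm_num) (by norm_num) gapCheck_12_even hr
      rw [e1, e2] at h; push_cast at h ⊢; linarith
    · have h := gapCheck_sound S0_pos (by norm_num) (by norm_num) gapCheck_12_odd hr
      rw [e1, e2] at h; push_cast at h ⊢; linarith
  · have hr : rOf (1.1 : ℝ) = ((11 : ℕ) : ℝ) / 100 / Real.log 10 := by
      rw [rOf]; field_simp; norm_num
    have e1 : (((26638 : ℕ) : ℝ) / ((100000 : ℕ) : ℝ)) = 1 / 2 - 0.23362 := by norm_num
    have e2 : (((1492 : ℕ) : ℝ) / ((1250 : ℕ) : ℝ)) = 1.1936 := by norm_num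
    rcases hκ' with rfl | rfl
    · have h := gapCheck_sound S0_pos (by norm_num) (by norm_num) gapCheck_11_even hr
      rw [e1, e2] at h; push_cast at h ⊢; linarith
    · have h := gapCheck_sound S0_pos (by norm_num) (by norm_num) gapCheck_11_odd hr
      rw [e1, e2] at h; push_cast at h ⊢; linarith

end GlobalBoundNumerics

/-! ### The restricted Theorem 2.1 for `q ≤ 4·10⁵`, proved -/

/-- `Re Γ_ℝ'/Γ_ℝ(σ + κ) = −½ log π + ½ Re ψ((σ + κ)/2)` for real `σ > 0` and `κ : ℕ`
(`Γ_ℝ(s) = π^{−s/2} Γ(s/2)`). [cite: MontgomeryVaughan2007, (10.30) and (C.10)] -/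
theorem re_logDeriv_Gammaℝ_ofReal_add_nat {σ : ℝ} (hσ : 0 < σ) (κ : ℕ) :
    (logDeriv Gammaℝ ((σ : ℂ) + (κ : ℂ))).re =
      -Real.log Real.pi / 2 + (Complex.digamma ((((σ + κ) / 2 : ℝ)) : ℂ)).re / 2 := by
  have hs : ∀ m : ℕ, ((σ : ℂ) + (κ : ℂ)) / 2 ≠ -(m : ℂ) := by
    intro m h
    have := congrArg Complex.re h
    simp only [Complex.div_ofNat_re, add_re, ofReal_re, natCast_re, neg_re] at this
    have hm : (0 : ℝ) ≤ m := m.cast_nonneg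
    have hk : (0 : ℝ) ≤ κ := κ.cast_nonneg
    linarith
  rw [Literature.NumberTheory.LFunctions.logDeriv_Gammaℝ hs]
  have e : ((σ : ℂ) + (κ : ℂ)) / 2 = ((((σ + κ) / 2 : ℝ)) : ℂ) := by push_cast; ring
  rw [e, add_re, neg_div, neg_re, Complex.div_ofNat_re, Complex.log_ofReal_re, Complex.div_ofNat_re]
  ring

/-- **Theorem 2.1 of Lu–Zaman–Zhao holds for every modulus `3 ≤ q ≤ 4·10⁵` and every real zero
`β₁ ∈ (½, 1)` — PROVED, independently of the printed proof.** From the global partial-fraction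
inequality WITH the partner zero `1 − β₁`
(`tsum_vonMangoldt_one_add_re_div_rpow_le_of_realZero`):
`Σ ≤ 1/r − ½log π + ½ψ((3+r)/2) + ½log q − ½log π + ½ψ((1+κ+r)/2) − 1/(σ−β₁) − 1/(r+β₁)`,
and `1/(r+β₁) > 1/(1+r)`, `(σ−β₁)/R² > r/R²`, `(½ − ϕ) log q ≤ (½ − ϕ) log(4·10⁵)`, so the printed
right side exceeds ours by more than the kernel-certified gap `GlobalBoundNumerics.gap_neg`
(thinnest case: `λ = 1.6`, odd `χ`, `q = 4·10⁵`: `0.0208`; the comparison reverses near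
`q ≈ 4.3·10⁵`, so this method does not extend the range much further).
[cite: LuZamanZhao2026, Theorem 2.1 and Table 1] -/
theorem theorem21UpTo_fourHundredThousand : theorem21UpTo 400000 := by
  intro q _ hq hqQ χ hprim β₁ hβ hβ1 hL lam phi E hrow
  have hne : χ ≠ 1 := SiegelZeroQuality.ne_one_of_isPrimitive hprim (by omega)
  obtain ⟨hr, -⟩ := rOf_pos_of_table1 hrow
  have hσ : 1 < 1 + rOf lam := by linarith
  have hmain := tsum_vonMangoldt_one_add_re_div_rpow_le_of_realZero hprim hne (by linarith)
    (show β₁ ≠ 1 / 2 by intro h; linarith) hL hσ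
  have hκ := charParity_le_one χ
  rw [re_logDeriv_Gammaℝ_ofReal_add_nat (by linarith) (charParity χ)] at hmain
  have eD : Complex.digamma (((1 + rOf lam : ℝ) : ℂ) / 2 + 1) =
      Complex.digamma ((((3 + rOf lam) / 2 : ℝ)) : ℂ) := by
    congr 1; push_cast; ring
  have eD' : Complex.digamma ((((1 + rOf lam + (charParity χ : ℕ)) / 2 : ℝ)) : ℂ) =
      Complex.digamma ((((1 + (charParity χ : ℕ) + rOf lam) / 2 : ℝ)) : ℂ) := by
    congr 1; push_cast; ring
  rw [eD, eD'] at hmain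
  have hgap := GlobalBoundNumerics.gap_neg hrow hκ
  -- the three monotone comparisons
  have hq3 : (3 : ℝ) ≤ q := by exact_mod_cast hq
  have hqQ' : (q : ℝ) ≤ 400000 := by exact_mod_cast hqQ
  have hlogq : Real.log q ≤ Real.log 400000 := Real.log_le_log (by linarith) hqQ'
  have hphi : 0 ≤ 1 / 2 - phi := by
    rcases hrow with ⟨-, rfl, -⟩ | ⟨-, rfl, -⟩ | ⟨-, rfl, -⟩ | ⟨-, rfl, -⟩ <;> norm_num
  have h1 : (1 / 2 - phi) * Real.log q ≤ (1 / 2 - phi) * Real.log 400000 :=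
    mul_le_mul_of_nonneg_left hlogq hphi
  have hR : 0 < (rOf lam + 7 / 8) ^ 2 := by positivity
  have h2 : rOf lam / (rOf lam + 7 / 8) ^ 2 ≤ (1 + rOf lam - β₁) / (rOf lam + 7 / 8) ^ 2 :=
    div_le_div_of_nonneg_right (by linarith) hR.le
  have h3 : 1 / (1 + rOf lam) ≤ 1 / (1 + rOf lam - 1 + β₁) :=
    one_div_le_one_div_of_le (by linarith) (by linarith)
  have e1 : 1 / (1 + rOf lam - 1) = 1 / rOf lam := by ring_nf
  rw [e1] at hmain
  linarith

end LuZamanZhao2026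

end Literature.NumberTheory.LFunctions

end
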